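import Summits.ResolutionOfSingularities.ResolutionOfSingularities.Theorems.FrobeniusLadderFInjectiveMacaulayficationVeroneseLocalization
import Summits.ResolutionOfSingularities.ResolutionOfSingularities.Theorems.FrobeniusLadderFInjectiveMacaulayficationGradedChartLaurentStep
import Summits.ResolutionOfSingularities.ResolutionOfSingularities.Theorems.FrobeniusLadderFInjectiveMacaulayficationFiniteGradedDescent
import Summits.ResolutionOfSingularities.ResolutionOfSingularities.Theorems.FrobeniusLadderFInjectiveMacaulayficationIntegralSubalgebraLocalDim
import Summits.ResolutionOfSingularities.ResolutionOfSingularities.Theorems.FrobeniusLadderFInjectiveMacaulayficationLaurentDescent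
import Summits.ResolutionOfSingularities.ResolutionOfSingularities.Theorems.FrobeniusLadderFInjectiveMacaulayficationCNConeFiModelRel
import Summits.ResolutionOfSingularities.ResolutionOfSingularities.Theorems.FrobeniusLadderFInjectiveMacaulayficationClauseOfMaximal
import Literature.RingTheory.KrullDimension.AffineDimension
import Mathlib.RingTheory.Localization.LocalizationLocalization
import HarnessLib

/-!
# (H3-gd-rel) THE GRADED CHART CLAUSE RELATIVE TO A COORDINATE STRATUM `V(X_J)` — `gradedChartClauseRel`
# (crux `FrobeniusLadder.FInjectiveMacaulayfication` stmt-ResolutionOfSingularities-15315, chain w45a; CRUX-PLAN v7 §3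
# «(H3-gd-rel) the relative GRADED engine (same J-device on G5/G5ᵍ: weights zero off J) — foreseen, unstaffed»;
# lead seat res-L1-w45a-lead-1 gen 3, hole #3 producer work)

[OURS · L1 W4.5a] AI-written; AI review is weaker than expert review. NOT a statement of any manuscript; no named fact.

THE STATEMENT. As G4 `GradedChartClause.gradedChartClause` (p488482): `k` a field of characteristic `p`, weights `w`
(NO positivity asked), `f` weighted homogeneous of weight `D` with `(f)` prime, `u = ā₀ ≠ 0` for a weighted homogeneous `a₀`
of weight `N > 0`, Veronese saturation of `I_N = (x^b : wt b ≥ N)`; the clause (Cohen–Macaulay + Frobenius-closed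
parameter ideals) for `R = k[X]/(f)` is now asked ONLY at the maximal ideals missing some `x̄ⱼ` with `j ∈ J` (off the
linear stratum `V(X_J)`), and `u` is asked to lie in `(x̄ⱼ : j ∈ J)`. THEN the weighted blow-up chart `C = R[I_N R/u]`
satisfies the clause at every maximal `Q ∋ u`.

THE PROOF is G4's (module docstring of p488482, steps 1–5) with ONE change: step 1 (`clause_away_rel`, the clause for
`L = R[1/u]` at every prime) uses the RELATIVE Jacobson step `CNConeFiModelRel.exists_maximal_not_mem_X_of_le`
(res-D-pv-017 AS res-L1-w45a-stub-5, p497132): a prime `𝔭 ∌ u` of `R` does not contain `(x̄ⱼ : j ∈ J) ∋ u`, so it lies below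
a maximal ideal missing some `x̄ⱼ`, `j ∈ J`, where the relative hoff applies. Steps 2–5 (coaction grading `WeightCoaction`,
chart iso `GradedChartIso`, `VeroneseSubalgebra`/`VeroneseRetract`/`VeroneseLocalization`, `FiniteGradedDescent`,
`GradedChartLaurentStep`) never look at the sign of a weight and are re-used verbatim. With `w = 0` off `J` the centre `I_N`
is supported on `V(X_J)`: this is the chart clause of the RELATIVE GRADED ENGINE `gradedConeFiModelRel` (next file), the
hole-#3 producer for weighted-homogeneous hypersurfaces along a linear stratum (first calibration `E₈⁰ × 𝔸¹`).
No definitions, no named facts. [folklore]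
-/

set_option linter.dupNamespace false

noncomputable section

open LaurentPolynomial Literature.AlgebraicGeometry.Resolution

namespace Summit.ResolutionOfSingularities.ResolutionOfSingularities.Theorems.FInjectiveMacaulayfication.GradedChartClauseRel

open Summit.ResolutionOfSingularities.ResolutionOfSingularities.Theorems.FInjectiveMacaulayfication
open WeightCoaction GradedChartIso VeroneseSubalgebra VeroneseRetract VeroneseLocalization GradedChartDescent
open GradedChartLaurentStep

/-! ## Step 1 (relative): the clause for `L = R[1/u]` at every prime, from the clause off `V(X_J)` -/

/-- **The clause for `L = R[1/u]` at every prime, relative form**: `u ∈ (x̄ⱼ : j ∈ J)` and the clause for `R = k[X]/(f)`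
at the maximal ideals missing some `x̄ⱼ`, `j ∈ J`. A prime `𝔮` of `L` contracts to `𝔭 ∌ u`; the relative Jacobson step
(`CNConeFiModelRel.exists_maximal_not_mem_X_of_le`) gives a maximal `Q₀ ⊇ 𝔭` missing some `x̄ⱼ`, `j ∈ J`; the clause
localises from `R_{Q₀}` to `R_𝔭 ≅ L_𝔮`. [folklore] -/
theorem clause_away_rel (p : ℕ) [Fact p.Prime] (k : Type) [Field k] [CharP k p] (n : ℕ) (J : Finset (Fin n))
    (f : MvPolynomial (Fin n) k)
    (hfprime : (Ideal.span {f}).IsPrime) (u : MvPolynomial (Fin n) k ⧸ Ideal.span {f})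
    (huX : u ∈ Ideal.span ((fun j : Fin n => Ideal.Quotient.mk (Ideal.span {f}) (MvPolynomial.X j)) '' (J : Set (Fin n))))
    (hoff : ∀ (Q : Ideal (MvPolynomial (Fin n) k ⧸ Ideal.span {f})) [Q.IsMaximal],
      (∃ j ∈ J, Ideal.Quotient.mk (Ideal.span {f}) (MvPolynomial.X j) ∉ Q) →
      ∀ d : ℕ, ringKrullDim (Localization.AtPrime Q) = d → ∀ s : Fin d → Localization.AtPrime Q,
        (Ideal.span (Set.range s)).radical.IsMaximal →
          RingTheory.Sequence.IsWeaklyRegular (Localization.AtPrime Q) (List.ofFn s) ∧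
          ∀ y : Localization.AtPrime Q, (∃ e : ℕ, y ^ p ^ e ∈ Ideal.span
            ((fun z : Localization.AtPrime Q => z ^ p ^ e) ''
              (Ideal.span (Set.range s) : Set (Localization.AtPrime Q)))) → y ∈ Ideal.span (Set.range s))
    (𝔮 : Ideal (Localization.Away u)) [𝔮.IsPrime] :
    ∀ d : ℕ, ringKrullDim (Localization.AtPrime 𝔮) = d → ∀ s : Fin d → Localization.AtPrime 𝔮,
      (Ideal.span (Set.range s)).radical.IsMaximal →
        RingTheory.Sequence.IsWeaklyRegular (Localization.AtPrime 𝔮) (List.ofFn s) ∧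
        ∀ y : Localization.AtPrime 𝔮, (∃ e : ℕ, y ^ p ^ e ∈ Ideal.span
          ((fun z : Localization.AtPrime 𝔮 => z ^ p ^ e) ''
            (Ideal.span (Set.range s) : Set (Localization.AtPrime 𝔮)))) → y ∈ Ideal.span (Set.range s) := by
  haveI := hfprime
  haveI : IsDomain (MvPolynomial (Fin n) k ⧸ Ideal.span {f}) := Ideal.Quotient.isDomain _
  haveI : CharP (MvPolynomial (Fin n) k ⧸ Ideal.span {f}) p :=
    charP_of_injective_algebraMap (algebraMap k (MvPolynomial (Fin n) k ⧸ Ideal.span {f})).injective p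
  -- the contraction `𝔭 ∌ u`
  haveI h𝔭 : (𝔮.comap (algebraMap (MvPolynomial (Fin n) k ⧸ Ideal.span {f}) (Localization.Away u))).IsPrime :=
    Ideal.comap_isPrime _ _
  have hu𝔭 : ¬ Ideal.span {u} ≤ 𝔮.comap (algebraMap (MvPolynomial (Fin n) k ⧸ Ideal.span {f}) (Localization.Away u)) := by
    intro h
    have hu : u ∈ 𝔮.comap (algebraMap _ (Localization.Away u)) := h (Ideal.mem_span_singleton_self u)
    rw [Ideal.mem_comap] at hu
    exact (Ideal.IsPrime.ne_top inferInstance) (𝔮.eq_top_of_isUnit_mem hu (IsLocalization.Away.algebraMap_isUnit u))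
  have hle : Ideal.span {u} ≤
      Ideal.span ((fun j : Fin n => Ideal.Quotient.mk (Ideal.span {f}) (MvPolynomial.X j)) '' (J : Set (Fin n))) := by
    rw [Ideal.span_le, Set.singleton_subset_iff]
    exact huX
  obtain ⟨Q₀, hQ₀, h𝔭Q₀, j, hjJ, hj⟩ :=
    CNConeFiModelRel.exists_maximal_not_mem_X_of_le f J (Ideal.span {u}) hle _ hu𝔭
  haveI := hQ₀
  have h := ClauseOfMaximal.fiClause_atPrime_of_le p h𝔭Q₀ ⟨inferInstance, hoff Q₀ ⟨j, hjJ, hj⟩⟩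
  exact DegreeZeroDescent.inlineClause_of_ringEquiv p
    (IsLocalization.localizationLocalizationAtPrimeIsoLocalization (Submonoid.powers u) 𝔮).toRingEquiv h.2

/-! ## Steps 2–5: the relative graded chart clause, general form -/

set_option maxHeartbeats 800000 in
/-- **THE GRADED CHART CLAUSE RELATIVE TO `V(X_J)` (general form).** `f` weighted homogeneous of weight `D` (weights
`w`, any signs of support), `(f)` prime, `u = ā₀ ≠ 0` for a weighted homogeneous `a₀` of weight `N > 0` lying in
`(x̄ⱼ : j ∈ J)`, Veronese saturation of `I_N`, and the clause for `R = k[X]/(f)` at the maximal ideals missing some `x̄ⱼ`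
with `j ∈ J`. Then the chart `C = R[I_N R/u]` satisfies the Cohen–Macaulay + Frobenius-closed clause at every maximal
ideal `Q ∋ u`. Proof = G4 `gradedChartClause` (p488482) verbatim with step 1 replaced by `clause_away_rel`. [folklore] -/
theorem gradedChartClauseRel (p : ℕ) [Fact p.Prime] (k : Type) [Field k] [CharP k p] (n : ℕ) (J : Finset (Fin n))
    (w : Fin n → ℕ)
    (f : MvPolynomial (Fin n) k) (D : ℕ) (hf : MvPolynomial.IsWeightedHomogeneous w f D) (hfprime : (Ideal.span {f}).IsPrime)
    (N : ℕ) (hN : 0 < N) (a₀ : MvPolynomial (Fin n) k) (ha₀ : MvPolynomial.IsWeightedHomogeneous w a₀ N)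
    (u : MvPolynomial (Fin n) k ⧸ Ideal.span {f}) (hu : Ideal.Quotient.mk (Ideal.span {f}) a₀ = u) (hu0 : u ≠ 0)
    (huX : u ∈ Ideal.span ((fun j : Fin n => Ideal.Quotient.mk (Ideal.span {f}) (MvPolynomial.X j)) '' (J : Set (Fin n))))
    (hpow : ∀ (K : ℕ) (b : Fin n →₀ ℕ), K * N ≤ Finsupp.weight w b → (MvPolynomial.monomial b (1 : k) : MvPolynomial (Fin n) k) ∈
      (Ideal.span {m : MvPolynomial (Fin n) k | ∃ b : Fin n →₀ ℕ, N ≤ Finsupp.weight w b ∧ m = MvPolynomial.monomial b 1}) ^ K)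
    (hoff : ∀ (Q : Ideal (MvPolynomial (Fin n) k ⧸ Ideal.span {f})) [Q.IsMaximal],
      (∃ j ∈ J, Ideal.Quotient.mk (Ideal.span {f}) (MvPolynomial.X j) ∉ Q) →
      ∀ d : ℕ, ringKrullDim (Localization.AtPrime Q) = d → ∀ s : Fin d → Localization.AtPrime Q,
        (Ideal.span (Set.range s)).radical.IsMaximal →
          RingTheory.Sequence.IsWeaklyRegular (Localization.AtPrime Q) (List.ofFn s) ∧
          ∀ y : Localization.AtPrime Q, (∃ e : ℕ, y ^ p ^ e ∈ Ideal.span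
            ((fun z : Localization.AtPrime Q => z ^ p ^ e) ''
              (Ideal.span (Set.range s) : Set (Localization.AtPrime Q)))) → y ∈ Ideal.span (Set.range s))
    (Q : Ideal (blowupAlgebra ((Ideal.span {m : MvPolynomial (Fin n) k | ∃ b : Fin n →₀ ℕ, N ≤ Finsupp.weight w b ∧
        m = MvPolynomial.monomial b 1}).map (Ideal.Quotient.mk (Ideal.span {f}))) u)) [Q.IsMaximal]
    (huQ : algebraMap (MvPolynomial (Fin n) k ⧸ Ideal.span {f}) (blowupAlgebra ((Ideal.span {m : MvPolynomial (Fin n) k |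
        ∃ b : Fin n →₀ ℕ, N ≤ Finsupp.weight w b ∧ m = MvPolynomial.monomial b 1}).map (Ideal.Quotient.mk (Ideal.span {f}))) u) u ∈ Q) :
    ∀ d : ℕ, ringKrullDim (Localization.AtPrime Q) = d → ∀ s : Fin d → Localization.AtPrime Q,
      (Ideal.span (Set.range s)).radical.IsMaximal →
        RingTheory.Sequence.IsWeaklyRegular (Localization.AtPrime Q) (List.ofFn s) ∧
        ∀ y : Localization.AtPrime Q, (∃ e : ℕ, y ^ p ^ e ∈ Ideal.span
          ((fun z : Localization.AtPrime Q => z ^ p ^ e) ''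
            (Ideal.span (Set.range s) : Set (Localization.AtPrime Q)))) → y ∈ Ideal.span (Set.range s) := by
  classical
  haveI := hfprime
  -- the rings `R`, `L = R[1/u]`, `L[s]`, `C`
  haveI : IsDomain (MvPolynomial (Fin n) k ⧸ Ideal.span {f}) := Ideal.Quotient.isDomain _
  haveI : CharP (MvPolynomial (Fin n) k ⧸ Ideal.span {f}) p :=
    charP_of_injective_algebraMap (algebraMap k (MvPolynomial (Fin n) k ⧸ Ideal.span {f})).injective p
  haveI : IsDomain (Localization.Away u) :=
    IsLocalization.isDomain_localization (powers_le_nonZeroDivisors_of_noZeroDivisors hu0)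
  haveI : IsNoetherianRing (Localization.Away u) :=
    IsLocalization.isNoetherianRing (Submonoid.powers u) (Localization.Away u) inferInstance
  haveI : CharP (Localization.Away u) p :=
    charP_of_injective_algebraMap (algebraMap k (Localization.Away u)).injective p
  haveI : Algebra.FiniteType k (Localization.Away u) :=
    (inferInstance : Algebra.FiniteType k (MvPolynomial (Fin n) k ⧸ Ideal.span {f})).trans
      (IsLocalization.finiteType_of_monoid_fg (Submonoid.powers u) (Localization.Away u))
  haveI : NeZero N := NeZero.of_pos hN
  -- the coaction and the graded objects
  obtain ⟨lam, hlam⟩ := exists_coaction w f u ha₀ hu D hf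
  obtain ⟨T₀, hT₀⟩ := exists_degreeZeroSubalgebra w f u lam hlam
  have hι' := exists_chartIso w f u ha₀ hu lam hlam hpow T₀ hT₀
  obtain ⟨ι, hι⟩ := hι'
  have hA'' := exists_veroneseSubalgebra w f u ha₀ hu lam hlam N
  obtain ⟨A', hA'⟩ := hA''
  have hρ' := exists_veroneseRetract w f u ha₀ hu lam hlam N A' hA'
  obtain ⟨ρ, hρ⟩ := hρ'
  haveI : Algebra.IsIntegral A' (Polynomial (Localization.Away u)) :=
    isIntegral_veronese w f u ha₀ hu lam hlam N A' hA' hN (ZMod.natCast_self N)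
  have hXN : (Polynomial.X : Polynomial (Localization.Away u)) ^ N ∈ A' :=
    X_pow_mem_veronese f u lam N A' hA' N (ZMod.natCast_self N)
  have hCinv : Polynomial.C (IsLocalization.Away.invSelf (S := Localization.Away u) u) ∈ A' :=
    C_mem_veronese_of_isHomogeneous f u lam N A' hA' (coaction_invSelf w f u ha₀ hu lam hlam)
      (by push_cast; rw [ZMod.natCast_self, neg_zero])
  have he' := exists_laurentLocalization w f u ha₀ hu lam hlam T₀ hT₀ A' hA' _ ι hN
  obtain ⟨e, heC, heX, hloc⟩ := he'
  -- steps 1–2: `L[s]` satisfies the clause at the maximal ideals containing `s`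
  have hclL := clause_away_rel p k n J f hfprime u huX hoff
  have hclB := fun (Q' : Ideal (Polynomial (Localization.Away u))) (hQ' : Q'.IsMaximal)
      (hXQ' : (Polynomial.X : Polynomial (Localization.Away u)) ∈ Q') =>
    (clause_localization_polynomial_of_mem p (Localization.Away u) (fun 𝔮 _ => hclL 𝔮) Q' hXQ').2
  -- step 3: equidimensionality and finite graded descent
  obtain ⟨m, hm, -⟩ := exists_ringKrullDim_eq_and_trdeg_eq k (Polynomial (Localization.Away u))
  have hdimB := fun (Q' : Ideal (Polynomial (Localization.Away u))) (hQ' : Q'.IsMaximal) =>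
    (ringKrullDim_localization_atPrime_eq_of_isMaximal k Q').trans hm
  have hdimA := IntegralSubalgebraLocalDim.stub_integralSubalgebraLocalDim k _ A' m hdimB
  have hclA' := FiniteGradedDescent.stub_finiteGradedDescent p k (Polynomial (Localization.Away u)) A' ρ hρ
    Polynomial.X N m hXN hdimB hdimA hclB
  -- steps 4–5: pull back along `C[Y] → A' = C[Y]_Y` and Laurent-descend to `C_Q`
  haveI : Algebra.FiniteType k (blowupAlgebra ((Ideal.span {m : MvPolynomial (Fin n) k | ∃ b : Fin n →₀ ℕ,
      N ≤ Finsupp.weight w b ∧ m = MvPolynomial.monomial b 1}).map (Ideal.Quotient.mk (Ideal.span {f}))) u) :=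
    (inferInstance : Algebra.FiniteType k (MvPolynomial (Fin n) k ⧸ Ideal.span {f})).trans
      (finiteType_blowupAlgebra _ (IsNoetherian.noetherian _) u)
  refine clause_of_isLocalization_away_descent p e hloc ⟨Polynomial.X ^ N, hXN⟩ hclA' Q _ huQ ⟨_, hCinv⟩
    (Subtype.ext ?_) (fun 𝔑 _ => ringKrullDim_localization_polynomial_succ k _ Q 𝔑)
  -- `s^N = (1/u) · ι(u)` in `L[s]`
  rw [Subalgebra.coe_mul, heC, chartIso_algebraMap_u w f u ha₀ hu lam hlam ι hι, ← mul_assoc, ← map_mul,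
    mul_comm (IsLocalization.Away.invSelf u), IsLocalization.Away.mul_invSelf, map_one, one_mul]

/-! ## The chart form used by the relative graded engine: `u = x̄_v ^ c` for a chart variable `v ∈ J` -/

/-- (H3-gd-rel, chart form) For `v ∈ J` with `0 < w v` and `c · w v = N`, `0 < c`: the clause off `V(X_J)` implies the
clause for the chart `R[I_N R/x̄_v^c]` at its maximal ideals containing `x̄_v^c` — `gradedChartClauseRel` with
`a₀ = monomial (single v c) 1` (`= X_v ^ c`). The element is written as a MONOMIAL so that the chart matches the relative
monomial core `CNConeFiModelRel.cnConeFiModelRel_of_chartClause` on the nose. [folklore] -/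
theorem gradedChartClauseRel_monomial (p : ℕ) [Fact p.Prime] (k : Type) [Field k] [CharP k p] (n : ℕ) (J : Finset (Fin n))
    (w : Fin n → ℕ) (v : Fin n) (hvJ : v ∈ J) (hw : 0 < w v) (N c D : ℕ) (hcN : c * w v = N) (hc : 0 < c)
    (hpow : ∀ (K : ℕ) (b : Fin n →₀ ℕ), K * N ≤ Finsupp.weight w b → (MvPolynomial.monomial b (1 : k) : MvPolynomial (Fin n) k) ∈
      (Ideal.span {m : MvPolynomial (Fin n) k | ∃ b : Fin n →₀ ℕ, N ≤ Finsupp.weight w b ∧ m = MvPolynomial.monomial b 1}) ^ K)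
    (f : MvPolynomial (Fin n) k) (hf : MvPolynomial.IsWeightedHomogeneous w f D) (hfprime : (Ideal.span {f}).IsPrime)
    (hXne : ∀ j : Fin n, Ideal.Quotient.mk (Ideal.span {f}) (MvPolynomial.X j) ≠ 0)
    (hoff : ∀ (Q : Ideal (MvPolynomial (Fin n) k ⧸ Ideal.span {f})) [Q.IsMaximal],
      (∃ j ∈ J, Ideal.Quotient.mk (Ideal.span {f}) (MvPolynomial.X j) ∉ Q) →
      ∀ d : ℕ, ringKrullDim (Localization.AtPrime Q) = d → ∀ s : Fin d → Localization.AtPrime Q,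
        (Ideal.span (Set.range s)).radical.IsMaximal →
          RingTheory.Sequence.IsWeaklyRegular (Localization.AtPrime Q) (List.ofFn s) ∧
          ∀ y : Localization.AtPrime Q, (∃ e : ℕ, y ^ p ^ e ∈ Ideal.span
            ((fun z : Localization.AtPrime Q => z ^ p ^ e) ''
              (Ideal.span (Set.range s) : Set (Localization.AtPrime Q)))) → y ∈ Ideal.span (Set.range s))
    (Q : Ideal (blowupAlgebra ((Ideal.span {m : MvPolynomial (Fin n) k | ∃ b : Fin n →₀ ℕ, N ≤ Finsupp.weight w b ∧
        m = MvPolynomial.monomial b 1}).map (Ideal.Quotient.mk (Ideal.span {f})))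
        (Ideal.Quotient.mk (Ideal.span {f}) (MvPolynomial.monomial (Finsupp.single v c) (1 : k)))))
      [Q.IsMaximal]
    (huQ : algebraMap (MvPolynomial (Fin n) k ⧸ Ideal.span {f}) (blowupAlgebra ((Ideal.span {m : MvPolynomial (Fin n) k |
        ∃ b : Fin n →₀ ℕ, N ≤ Finsupp.weight w b ∧ m = MvPolynomial.monomial b 1}).map (Ideal.Quotient.mk (Ideal.span {f})))
          (Ideal.Quotient.mk (Ideal.span {f}) (MvPolynomial.monomial (Finsupp.single v c) (1 : k))))
        (Ideal.Quotient.mk (Ideal.span {f}) (MvPolynomial.monomial (Finsupp.single v c) (1 : k))) ∈ Q) :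
    ∀ d : ℕ, ringKrullDim (Localization.AtPrime Q) = d → ∀ s : Fin d → Localization.AtPrime Q,
      (Ideal.span (Set.range s)).radical.IsMaximal →
        RingTheory.Sequence.IsWeaklyRegular (Localization.AtPrime Q) (List.ofFn s) ∧
        ∀ y : Localization.AtPrime Q, (∃ e : ℕ, y ^ p ^ e ∈ Ideal.span
          ((fun z : Localization.AtPrime Q => z ^ p ^ e) ''
            (Ideal.span (Set.range s) : Set (Localization.AtPrime Q)))) → y ∈ Ideal.span (Set.range s) := by
  haveI := hfprime
  haveI : IsDomain (MvPolynomial (Fin n) k ⧸ Ideal.span {f}) := Ideal.Quotient.isDomain _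
  have hXc : (MvPolynomial.monomial (Finsupp.single v c) (1 : k) : MvPolynomial (Fin n) k) = MvPolynomial.X v ^ c := by
    rw [MvPolynomial.X_pow_eq_monomial]
  have ha₀ : MvPolynomial.IsWeightedHomogeneous w (MvPolynomial.monomial (Finsupp.single v c) (1 : k) : MvPolynomial (Fin n) k) N := by
    have h := (MvPolynomial.isWeightedHomogeneous_X k w v).pow c
    rwa [smul_eq_mul, hcN, ← hXc] at h
  have hN : 0 < N := hcN ▸ Nat.mul_pos hc hw
  have hu0 : Ideal.Quotient.mk (Ideal.span {f}) (MvPolynomial.monomial (Finsupp.single v c) (1 : k)) ≠ 0 := by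
    rw [hXc, map_pow]
    exact pow_ne_zero c (hXne v)
  have huX : Ideal.Quotient.mk (Ideal.span {f}) (MvPolynomial.monomial (Finsupp.single v c) (1 : k)) ∈
      Ideal.span ((fun j : Fin n => Ideal.Quotient.mk (Ideal.span {f}) (MvPolynomial.X j)) '' (J : Set (Fin n))) := by
    rw [hXc, map_pow]
    exact Ideal.pow_mem_of_mem _ (Ideal.subset_span (Set.mem_image_of_mem
      (fun j : Fin n => Ideal.Quotient.mk (Ideal.span {f}) (MvPolynomial.X j)) (Finset.mem_coe.mpr hvJ))) c hc
  exact gradedChartClauseRel p k n J w f D hf hfprime N hN _ ha₀ _ rfl hu0 huX hpow hoff Q huQ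

end Summit.ResolutionOfSingularities.ResolutionOfSingularities.Theorems.FInjectiveMacaulayfication.GradedChartClauseRel

end
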